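import Summits.CriticalPhenomena.PercolationContinuityZ3.Theorems.Transplant.StepGraphInstances
import Summits.CriticalPhenomena.PercolationContinuityZ3.Theorems.Transplant.UniqZoneGeneric
import Literature.Probability.LatticeModels.ThermodynamicLimit
import HarnessLib

/-!
# PHASE 2 / F3: the uniqueness zone (KN Lemma 7) over the boxes `Λ_n` of a translation-invariant range-1 graph on `ℤ^d` — in particular
# of every `stepGraph d S` — from Burton–Keane uniqueness (README §PHASE 2 F3: "UniquenessZone; needs Burton–Keane q.t. + amenability of
# stepGraph instead of UniquenessInfiniteCluster")

builds on p205010 (kernel theorem, internal audit signed; external expert review pending) — nothing in this file uses p205010.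
Lane `prim-bschramm`, PHASE 2 file F3 (the (I-a) dry run: `UniquenessZone.lean` re-typed for `stepGraph d S`); seat `prim-bschramm-p2`; helper file.
No definitions, no sorries: F3 is the generic uniqueness zone `UniqZone.exists_forall_le_lt_real_zone` (`Transplant/UniqZoneGeneric.lean`) over
`Λ n = box d n`, whose hypotheses are discharged by `TransInv.outerBoundary_box_subset` (margin, range-1 steps), `box_mono`, `zero`-centred
exhaustion, and the input U `TransInv.numInfiniteClusters_le_one` / `stepGraph_numInfiniteClusters_le_one` (Burton–Keane, tree).

* `TransInv.exists_forall_le_lt_real_uniqZone_box` — for a translation-invariant range-1 connected locally finite `G` on `ℤ^d`;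
* `stepGraph_exists_forall_le_lt_real_uniqZone_box` — for `stepGraph d S`, `S` admissible.
COST (F3 dry run): 0 proof repairs of the original's 303 lines — the generic file did the work once; F3 itself is two corollaries.

[cite: KozmaNitzan2024, §4 Lemma 7 (p. 15)] [cite: MartineauTassion2017, §3.3 (Lemma 3.7)] [cite: BurtonKeane1989, Thm. 2]
-/

noncomputable section

namespace Summit.CriticalPhenomena.PercolationContinuityZ3.Theorems

namespace Transplant

open MeasureTheory Literature.Probability.Percolation Literature.Probability.LatticeModels

variable {d : ℕ}

/-- Every vertex of `ℤ^d` lies in some box `Λ_n`. [folklore] -/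
theorem exists_mem_box (v : Site d) : ∃ n : ℕ, v ∈ box d n := by
  classical
  refine ⟨∑ i, (v i).natAbs, ?_⟩
  rw [mem_box]
  intro i
  have hi : (v i).natAbs ≤ ∑ j, (v j).natAbs :=
    Finset.single_le_sum (f := fun j => (v j).natAbs) (fun _ _ => Nat.zero_le _) (Finset.mem_univ i)
  constructor <;> omega

namespace TransInv

/-- **KN Lemma 7 over boxes for a translation-invariant range-1 graph on `ℤ^d`**: for every `k`, `η > 0` there is `n₀` with
`P_p(UniqZone.zone G box k n) > 1 − η` for all `n ≥ n₀` (any `p`; uniqueness by Burton–Keane). [cite: KozmaNitzan2024, §4 Lemma 7] -/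
theorem exists_forall_le_lt_real_uniqZone_box (G : SimpleGraph (Site d)) [G.LocallyFinite] [DecidableRel G.Adj]
    (hT : ∀ v x y : Site d, G.Adj (x + v) (y + v) ↔ G.Adj x y) (hR : ∀ x y : Site d, G.Adj x y → ∀ i : Fin d, |y i - x i| ≤ 1)
    (hconn : G.Connected) (p : unitInterval) (k : ℕ) {η : ℝ} (hη : 0 < η) :
    ∃ n₀ : ℕ, ∀ n, n₀ ≤ n → 1 - η < (bondPercolation G p).real (UniqZone.zone G (box d) k n) :=
  UniqZone.exists_forall_le_lt_real_zone p (numInfiniteClusters_le_one G hT hR hconn p)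
    (fun n => (outerBoundary_box_subset G hR n).trans Finset.sdiff_subset) (box_mono d) exists_mem_box k hη

end TransInv

/-- **PHASE 2 / F3: KN Lemma 7 (uniqueness zone over boxes) for `stepGraph d S`**, `S` admissible, every `p`.
[cite: KozmaNitzan2024, §4 Lemma 7] [cite: BurtonKeane1989, Thm. 2] -/
theorem stepGraph_exists_forall_le_lt_real_uniqZone_box {S : Finset (Site d)} (hS : AdmissibleSteps d S) (p : unitInterval) (k : ℕ)
    {η : ℝ} (hη : 0 < η) :
    ∃ n₀ : ℕ, ∀ n, n₀ ≤ n → 1 - η < (bondPercolation (stepGraph d S) p).real (UniqZone.zone (stepGraph d S) (box d) k n) :=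
  TransInv.exists_forall_le_lt_real_uniqZone_box (stepGraph d S) (stepGraph_adj_add_right S) (fun _ _ h i => stepGraph_abs_sub_le hS h i)
    (stepGraph_connected hS) p k hη

end Transplant

end Summit.CriticalPhenomena.PercolationContinuityZ3.Theorems

end
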